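import Literature.AlgebraicGeometry.DuqueFrancoVillaflor2025.ZeroDimensionalFakeLinearCycles
import Literature.AlgebraicGeometry.DuqueFrancoVillaflor2023.FakeLinearCycleQuadraticForm
import Mathlib.RingTheory.MvPolynomial.EulerIdentity
import HarnessLib

/-!
# The quadratic fundamental form at a `0`-dimensional fake linear cycle does not vanish
# (Duque Franco–Villaflor 2025, proof of Thm. 7.2: `q_i(x_{2i} − cx_{2i+1}, x_{2i} − cx_{2i+1}) = a + bc = d·F_i(c,1) ≠ 0`)

Certified instances and evidence bearing on the general Hodge conjecture; no claim.

J. Duque Franco, R. Villaflor Loyola, *Periods of join algebraic cycles*, Ann. Sc. Norm. Super. Pisa (2025)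
= arXiv:2312.17222 [DuqueFrancoVillaflor2025Join] (held text `paper:arxiv-2312.17222`; §7 numbering identical in
arXiv v1–v4). **Theorem 7.2** (p. 19, verbatim, v1–v3 wording): "Let `n` an even number and `d ≥ 2 + 6/n` an
integer. For any degree `d` homogeneous polynomials `F_0, …, F_{n/2} ∈ ℚ[x,y]_d` with no multiple roots, let
`X = {F_0(x_0,x_1) + F_1(x_2,x_3) + ⋯ + F_{n/2}(x_n,x_{n+1}) = 0} ⊆ ℙ^{n+1}`. For each `i = 0, …, n/2` consider
`X_i := {F_i(x_{2i},x_{2i+1}) = 0} ⊆ ℙ¹` and some `δ_i ∈ H⁰(X_i,ℚ)_prim` with `HF_{δ_i}` equal to the Hilbert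
function of a point. Let `δ := J(δ_1, …, δ_{n/2})`, then `δ` is a fake linear cycle if and only if `V_δ` is not
smooth" (v4: "… if and only if `V_δ` is not non-reduced or is reduced and singular at `X`"). **Its proof**, the
step formalised here (verbatim): "If some `δ_i` is a `0`-dimensional fake linear cycle, then we can write (up to
scalar multiplication) `δ_i = res(P·(x_{2i}dx_{2i+1} − x_{2i+1}dx_{2i})/F_i)` for
`P = (a ∂F_i/∂x_{2i} − b ∂F_i/∂x_{2i+1})/(x_{2i} − cx_{2i+1})` where `a = ∂F_i/∂x_{2i+1}(c,1)`,
`b = ∂F_i/∂x_{2i}(c,1)` and `F_i(c,1) ≠ 0`. If we compute the quadratic fundamental form `q_i` of `V_{δ_i}` at the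
term `x_{2i} − cx_{2i+1} ∈ J^{F_i,δ_i}_1` we get `q_i(x_{2i} − cx_{2i+1}, x_{2i} − cx_{2i+1}) = a + bc = d·F_i(c,1) ≠ 0`."
(The proof then transfers this to `V_δ` by Thm. 1.3 (ii) [v4: Thm. 4.1 (ii)] with `e = d`, `ℓ = 1`, `j = 2d−5`,
`k = 0` — NOT formalised here.) The form `q` is **Theorem 2.1 (Maclean)**, eq. (eqQFF):
`q(G,H) = Σ_i (H ∂Q_i/∂x_i − R_i ∂G/∂x_i)` where `G·P_λ = Σ_i Q_i ∂F/∂x_i`, `H·P_λ = Σ_i R_i ∂F/∂x_i`, with values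
in `R^F/⟨P_λ⟩` — the tree's `DuqueFrancoVillaflor2023.macleanForm G H Q R` (same printed expression, from the
companion paper [DuquefrancoVillaflorloyola2023] Thm. 6.1).

## What this file PROVES (0 facts, 0 sorry), over any field `K`

For a binary form `F ∈ K[x₀,x₁]` and `c ∈ K`, with DFV's `a = F_{x₁}(c,1)`, `b = F_{x₀}(c,1)` and the lifts
`Q = (a, −b)` (`dfvLift F c`) of `G = x₀ − cx₁` — valid for EVERY `P` with `P·(x₀ − cx₁) = aF_{x₀} − bF_{x₁}`
(`pointForm_mul_eq_sum_dfvLift`: "`G·P = Σ Q_i ∂F/∂x_i`"):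
* `macleanForm_pointForm` — `q(x₀ − cx₁, x₀ − cx₁) = −(a + bc)` as a polynomial (a constant); the printed value
  "`a + bc`" is this up to the sign, which is immaterial for the (non-)vanishing;
* `macleanForm_pointForm_eq_neg_euler` — `= −d·F(c,1)` for `F` homogeneous of degree `d` (Euler at `(c:1)`, tree
  `euler_eval_point`: "`a + bc = d·F_i(c,1)`");
* **`macleanForm_pointForm_not_mem`** — for `d ≥ 3`, `F` of degree `d`, `d·F(c,1) ≠ 0` (i.e. `c` not a root and
  `d ≠ 0` in `K` — the fake case of Thm. 7.1) and ANY form `P` of positive degree: this value is NOT in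
  `J^F + ⟨P⟩`, i.e. `q_i(x₀ − cx₁, x₀ − cx₁) ≠ 0` in `R^F/⟨P⟩` ("`≠ 0`"); on the printed `F = ∏(x₀ − r_ix₁)`
  (`splitForm r`): `macleanForm_pointForm_splitForm_not_mem` for every `c ∉ {r_i}` (no use is made of the simplicity of the roots).
By contrast, for a genuine point `c = r_i` the same value is `−d·F(r_i,1) = 0` (`macleanForm_pointForm_root`),
consistent with "`V_δ` is known to be smooth" for linear cycles.

Not formalised (cited): Maclean's theorem itself (that `q` is the quadratic fundamental form of `V_{δ_i}` and
vanishes when `V_{δ_i}` is smooth), Thm. 1.3/4.1 (ii) (transfer to the join `δ`), and hence the conclusion of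
Thm. 7.2 for `V_δ`.
-/

noncomputable section

open MvPolynomial
open Literature.AlgebraicGeometry.Motives.UniversalHypersurface
open Literature.AlgebraicGeometry.DuqueFrancoVillaflor2023 (macleanForm)

namespace Literature.AlgebraicGeometry.DuqueFrancoVillaflor2025

universe u

variable {K : Type u} [Field K] {d : ℕ} {F : MvPolynomial (Fin 2) K}

/-- **DFV's lifts for `G = x₀ − cx₁`**: `G·P = aF_{x₀} − bF_{x₁}`, so `Q₀ = a = F_{x₁}(c,1)`, `Q₁ = −b = −F_{x₀}(c,1)`
(constants). [cite: DuqueFrancoVillaflor2025Join, Theorem 7.2 (proof)] -/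
def dfvLift (F : MvPolynomial (Fin 2) K) (c : K) : Fin 2 → MvPolynomial (Fin 2) K :=
  ![C (eval ![c, 1] (pderiv 1 F)), -C (eval ![c, 1] (pderiv 0 F))]

/-- `Q₀ = a`. [cite: DuqueFrancoVillaflor2025Join, Theorem 7.2 (proof)] -/
@[simp] theorem dfvLift_zero (F : MvPolynomial (Fin 2) K) (c : K) :
    dfvLift F c 0 = C (eval ![c, 1] (pderiv 1 F)) := rfl

/-- `Q₁ = −b`. [cite: DuqueFrancoVillaflor2025Join, Theorem 7.2 (proof)] -/
@[simp] theorem dfvLift_one (F : MvPolynomial (Fin 2) K) (c : K) :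
    dfvLift F c 1 = -C (eval ![c, 1] (pderiv 0 F)) := rfl

/-- **"`G·P_δ = Σ_i Q_i ∂F/∂x_i`" for `G = x₀ − cx₁`**: for every `P` with `P·(x₀ − cx₁) = aF_{x₀} − bF_{x₁}`
(DFV's `P` of Thm. 7.1, tree `dfvNumerator` / `exists_dfvPolynomial`), `(x₀ − cx₁)·P = Σ_i Q_i ∂F/∂x_i` with the
constant lifts `Q = (a, −b)`. [cite: DuqueFrancoVillaflor2025Join, Theorem 7.2 (proof) and Theorem 2.1] -/
theorem pointForm_mul_eq_sum_dfvLift {c : K} {P : MvPolynomial (Fin 2) K}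
    (hP : P * pointForm c = dfvNumerator F c) :
    pointForm c * P = ∑ i, dfvLift F c i * pderiv i F := by
  rw [mul_comm, hP, dfvNumerator, Fin.sum_univ_two, dfvLift_zero, dfvLift_one, neg_mul, sub_eq_add_neg]

/-- **The value `q(x₀ − cx₁, x₀ − cx₁) = −(a + bc)`** of Maclean's form (eq. (eqQFF):
`Σ_i (H ∂Q_i/∂x_i − R_i ∂G/∂x_i)`) at `G = H = x₀ − cx₁` with the lifts `Q = R = (a, −b)`: the `Q_i` are constants,
`∂G/∂x₀ = 1`, `∂G/∂x₁ = −c`. (Printed: "`= a + bc`", the sign being immaterial.)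
[cite: DuqueFrancoVillaflor2025Join, Theorem 7.2 (proof) and Theorem 2.1, eq. (eqQFF)] -/
theorem macleanForm_pointForm (F : MvPolynomial (Fin 2) K) (c : K) :
    macleanForm (pointForm c) (pointForm c) (dfvLift F c) (dfvLift F c) =
      -C (c * eval ![c, 1] (pderiv 0 F) + eval ![c, 1] (pderiv 1 F)) := by
  have h0 : pderiv 0 (pointForm c) = 1 := by
    rw [pointForm, map_sub, pderiv_X_self, pderiv_C_mul, pderiv_X_of_ne (by decide : (1 : Fin 2) ≠ 0), mul_zero,
      sub_zero]
  have h1 : pderiv 1 (pointForm c) = -C c := by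
    rw [pointForm, map_sub, pderiv_X_of_ne (by decide : (0 : Fin 2) ≠ 1), pderiv_C_mul, pderiv_X_self, mul_one,
      zero_sub]
  simp only [macleanForm, Fin.sum_univ_two, dfvLift_zero, dfvLift_one, pderiv_C, map_neg, neg_zero, mul_zero,
    zero_sub, h0, h1, mul_one, map_add, map_mul]
  ring

/-- **"`a + bc = d·F_i(c,1)`"**: for `F` homogeneous of degree `d`, `q(x₀ − cx₁, x₀ − cx₁) = −d·F(c,1)` (Euler at
`(c : 1)`, tree `euler_eval_point`). [cite: DuqueFrancoVillaflor2025Join, Theorem 7.2 (proof)] -/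
theorem macleanForm_pointForm_eq_neg_euler (hF : F.IsHomogeneous d) (c : K) :
    macleanForm (pointForm c) (pointForm c) (dfvLift F c) (dfvLift F c) = -C ((d : K) * eval ![c, 1] F) := by
  rw [macleanForm_pointForm, euler_eval_point hF c]

/-- At a genuine point (`F(c,1) = 0`, e.g. `c = r_i` a root) the value vanishes — consistent with "`V_δ` is known
to be smooth" for linear cycles. [cite: DuqueFrancoVillaflor2025Join, Theorem 7.2 (proof)] -/
theorem macleanForm_pointForm_root (hF : F.IsHomogeneous d) {c : K} (hc : eval ![c, 1] F = 0) :
    macleanForm (pointForm c) (pointForm c) (dfvLift F c) (dfvLift F c) = 0 := by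
  rw [macleanForm_pointForm_eq_neg_euler hF, hc, mul_zero, C_0, neg_zero]

/-- An ideal generated by polynomials without constant term contains no polynomial with a non-zero constant
term. [folklore] -/
private theorem constantCoeff_eq_zero_of_mem_span {σ : Type*} {S : Set (MvPolynomial σ K)}
    (hS : ∀ s ∈ S, constantCoeff s = 0) {g : MvPolynomial σ K} (hg : g ∈ Ideal.span S) : constantCoeff g = 0 := by
  have h : Ideal.span S ≤ RingHom.ker (constantCoeff : MvPolynomial σ K →+* K) :=
    Ideal.span_le.mpr fun s hs => (RingHom.mem_ker).mpr (hS s hs)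
  exact (RingHom.mem_ker).mp (h hg)

/-- A form of positive degree has no constant term. [folklore] -/
private theorem constantCoeff_eq_zero_of_isHomogeneous {σ : Type*} {g : MvPolynomial σ K} {e : ℕ}
    (hg : g.IsHomogeneous e) (he : e ≠ 0) : constantCoeff g = 0 := by
  rw [constantCoeff_eq]
  exact hg.coeff_eq_zero (by simpa using he.symm)

/-- **`q_i(x₀ − cx₁, x₀ − cx₁) ≠ 0` in `R^F/⟨P⟩`** (the non-vanishing step of the proof of Thm. 7.2): for `F`
homogeneous of degree `d ≥ 3` with `d·F(c,1) ≠ 0` (`c` not a root, `d ≠ 0` in `K`: `δ` is a `0`-dimensional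
FAKE linear cycle, Thm. 7.1) and any form `P` of positive degree `e` (DFV: `P_δ` of degree `d − 2 ≥ 1`), the value
`−d·F(c,1)` is a non-zero constant, whereas `J^F + ⟨P⟩` is generated by forms of positive degree:
`q(x₀ − cx₁, x₀ − cx₁) ∉ J^F + ⟨P⟩`. [cite: DuqueFrancoVillaflor2025Join, Theorem 7.2 (proof)] -/
theorem macleanForm_pointForm_not_mem (hd : 3 ≤ d) (hF : F.IsHomogeneous d) {c : K}
    (hc : (d : K) * eval ![c, 1] F ≠ 0) {P : MvPolynomial (Fin 2) K} {e : ℕ} (hP : P.IsHomogeneous e)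
    (he : e ≠ 0) :
    macleanForm (pointForm c) (pointForm c) (dfvLift F c) (dfvLift F c) ∉ jacobianIdeal F ⊔ Ideal.span {P} := by
  intro hmem
  rw [macleanForm_pointForm_eq_neg_euler hF, jacobianIdeal, ← Ideal.span_union] at hmem
  have h0 := constantCoeff_eq_zero_of_mem_span (fun s hs => ?_) hmem
  · rw [map_neg, constantCoeff_C, neg_eq_zero] at h0
    exact hc h0
  · rcases hs with ⟨i, rfl⟩ | hs
    · refine constantCoeff_eq_zero_of_isHomogeneous (e := d - 1) ?_ (by omega)
      exact (hF.pderiv (i := i))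
    · rw [Set.mem_singleton_iff] at hs
      subst hs
      exact constantCoeff_eq_zero_of_isHomogeneous hP he

/-- **On the printed `X = {∏(x₀ − r_ix₁) = 0} ⊂ ℙ¹`** (`d ≥ 3`, `d ≠ 0` in `K`; any roots `r_i`): for every
`c ∉ {r_i}` — every `0`-dimensional fake linear cycle `δ` of Thm. 7.1 — and every `P` of degree `d − 2` (in
particular DFV's `P` with `P·(x₀ − cx₁) = aF_{x₀} − bF_{x₁}`, for which `Q = (a, −b)` ARE the lifts of `x₀ − cx₁`:
`pointForm_mul_eq_sum_dfvLift`), `q(x₀ − cx₁, x₀ − cx₁) ∉ J^F + ⟨P⟩`.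
[cite: DuqueFrancoVillaflor2025Join, Theorem 7.2 (proof) and Theorem 7.1] -/
theorem macleanForm_pointForm_splitForm_not_mem (r : Fin d → K) (hd : 3 ≤ d) (hdK : (d : K) ≠ 0) {c : K}
    (hc : ∀ i, c ≠ r i) {P : MvPolynomial (Fin 2) K} (hP : P.IsHomogeneous (d - 2)) :
    macleanForm (pointForm c) (pointForm c) (dfvLift (splitForm r) c) (dfvLift (splitForm r) c) ∉
      jacobianIdeal (splitForm r) ⊔ Ideal.span {P} :=
  macleanForm_pointForm_not_mem hd (isHomogeneous_splitForm r)
    (mul_ne_zero hdK ((eval_splitForm_ne_zero_iff r c).mpr hc)) hP (by omega)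

end Literature.AlgebraicGeometry.DuqueFrancoVillaflor2025

end
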